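import Literature.Analysis.InnerProduct.EquilateralTriangleHeatTraceExpansion
import HarnessLib

/-!
# The hemiequilateral (30°–60°–90°) triangle `H_ℓ` (half of Lamé's triangle `T_ℓ`, hypotenuse `ℓ`): Dirichlet spectrum
# `{(16π²/(9ℓ²))(m² + mn + n²) : m > n ≥ 1}` (Bérard–Helffer §10.2), `Z_H = (Z_T − ∑_{n≥1}e^{−3tcn²})/2`, hence
# `Z_H(t) = |H|/(4πt) − |∂H|/(8√(πt)) + 5/12 + O(t^∞)` — KAC'S THREE DIFFERENT CORNERS `π/2, π/3, π/6`:
# `1/16 + 1/9 + 35/144 = 5/12`; Weyl, `ζ_H(0) = 5/12`, and `H` is heard among rectangles and the other two triangles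

Layer `Literature/Analysis/InnerProduct`, namespace `Literature.Analysis.InnerProduct`; sequel to row g39-#10
(`EquilateralTriangleHeatTraceExpansion.lean`, IMPORTED: `summable_exp_neg_mul_equilateralTriangle`,
`isBigO_equilateralTriangle_heatTrace_sub`, `tendsto_equilateralTriangle_cofinite_atTop`,
`isBigO_equilateralTriangle_heatTrace_expansion`), using the Dirichlet interval of row g38-#2
(`summable_exp_neg_mul_dirichletInterval`, `isBigO_dirichletInterval_heatTrace_sub`, `tendsto_dirichletRectangle_cofinite_atTop`,
`isBigO_dirichletRectangle_heatTrace_expansion`), the isosceles right triangle of row g39-#6 and the abstract continuation / inverse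
results of rows g37-#1/#3/#6/#10 (`Gamma_mul_tsum_cpow_neg_eq_of_expansion`, `tendsto_continuation_nhdsNE_zero`,
`exists_analyticAt_continuation_zero`, `tendsto_sub_mul_continuation_nhdsNE`, `tendsto_ncard_le_div_rpow_of_expansion`,
`heatCoeff_eq_of_ncard_eq`). Lane `lit-hodgefound` (Track 2 foundations library), prover seat `lit-hodgefound-p06` (generation 39),
self-proposed row g39-#11. THEOREMS ONLY (no definition, no instance, no notation, no named fact).

## Sources, verbatim

P. Bérard, B. Helffer, *Courant-sharp eigenvalues for the equilateral torus, and for the equilateral triangle*, Lett. Math. Phys.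
106 (2016) (arXiv:1503.00117), §10.2 "The hemiequilateral triangle" (chunk p0025): "A complete set of Dirichlet eigenfunctions of
the hemiequilateral triangle `H`, with hypothenuse of length `1`, is given by the functions `C_{m,n}` described in (ETR-8a), with
`1 ≤ n < m`. The associated eigenvalues are the numbers `(16π²/9)(m²+mn+n²)`." and "The lower bound (ETR-12) yields the following
lower bound for the counting function of the Dirichlet eigenvalues of `H`, `N_H(λ) ≥ (√3/(32π))λ − ((6+√3)/(8π))√λ + ½`"; §1
(chunk p0010): "The medians divide the triangle `T` into six isometric hemiequilateral triangles". H. P. McKean, I. M. Singer,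
J. Differential Geom. 1 (1967), p. 43–44, eq. (4a): "Kac proved that for `D` bounded by a broken line `B`, `Z = area D/(4πt) −
length B/(8√(πt)) + ∑ (π² − γ²)/(24πγ) + o(1)`, the sum running over the corners, `γ` being the inside-facing angle". M. Kac
(1966), §13–§15. P. B. Gilkey (1995), §1.10 Lemma 1.10.1. P. H. Bérard (1986), Ch. III nº31; Ch. VII.

## The computation

`c = 16π²/(9ℓ²)`, `Q(m,n) = m² + mn + n²`. Lamé's Dirichlet spectrum of `T_ℓ` is `{cQ(m,n) : m,n ≥ 1}` (row g39-#10); the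
`T`-eigenfunctions odd under the reflection in a median are the Dirichlet eigenfunctions of the half triangle `H_ℓ` (angles
`π/2, π/3, π/6`, hypotenuse `ℓ`, legs `ℓ/2` and `(√3/2)ℓ`): spectrum `{cQ(m,n) : m > n ≥ 1}`. Since `Q` is symmetric and
`Q(n,n) = 3n²`, `Z_T = 2Z_H + ∑_{n≥1}e^{−3tcn²}`, the last sum being the Dirichlet interval of length `√3ℓ/4` (`(π/(√3ℓ/4))² = 3c`):
`Z_H = ½(|T|/(4πt) − 3ℓ/(8√(πt)) + 1/3) − ½((√3ℓ/4)/(2√(πt)) − ½) + O(t^∞) = (√3/8)ℓ²/(4πt) − (3+√3)ℓ/(16√(πt)) + 5/12 + O(t^∞)`: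
area `|H| = (√3/8)ℓ²`, perimeter `(3+√3)ℓ/2` (`/(8√π)` gives `(3+√3)ℓ/(16√π)`), and Kac's corners
`(π²−γ²)/(24πγ)` at `γ = π/2, π/3, π/6`: `1/16 + 1/9 + 35/144 = 60/144 = 5/12`.

## What is proved

* §0 **`kac_corner_terms_hemiequilateralTriangle`** (`= 5/12`); private trichotomy and normalisations.
* §1 **`summable_exp_neg_mul_hemiequilateralTriangle`**, **`tsum_exp_neg_mul_equilateralTriangle_eq_hemi`** (`Z_T = 2Z_H + ∑e^{−3tc(n+1)²}`),
  **`tsum_exp_neg_mul_hemiequilateralTriangle`**, **`isBigO_hemiequilateralTriangle_heatTrace_sub`** (`Z_H − ((√3/8)ℓ²/(4π)t^{−1} −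
  (3+√3)ℓ/(16√π)t^{−1/2} + 5/12) = O(t^β)` ∀β), **`isBigO_hemiequilateralTriangle_heatTrace_sub_kac`** (Kac's (4a) verbatim shape with
  the three corners), `isBigO_hemiequilateralTriangle_heatTrace_expansion` (`κ = Fin 3`), `tendsto_hemiequilateralTriangle_cofinite_atTop`,
  `ncard_setOf_hemiequilateralTriangle_eq_zero`.
* §2 **`tendsto_ncard_hemiequilateralTriangle_le_div`** (WEYL `(√3/8)ℓ²/(4π) = √3ℓ²/(32π)`, the leading term of Bérard–Helffer's
  (ETR-12) bound), **`Gamma_mul_tsum_hemiequilateralTriangle_cpow_neg_eq`**, **`tendsto_hemiequilateralTriangleZeta_continuation_nhdsNE_zero`**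
  (`ζ_H(0) = 5/12`), `exists_analyticAt_hemiequilateralTriangleZeta_continuation_zero`,
  `tendsto_sub_one_mul_hemiequilateralTriangleZeta_continuation`.
* §3 **`not_isospectral_hemiequilateralTriangle_rectangle`** (`5/12 ≠ ¼`), **`not_isospectral_hemiequilateralTriangle_equilateralTriangle`**
  (`5/12 ≠ 1/3`), **`not_isospectral_hemiequilateralTriangle_isoscelesRightTriangle`** (`5/12 ≠ 3/8`),
  **`eq_of_isospectral_hemiequilateralTriangles`**.

## References

* [BerardHelffer2016] P. Bérard, B. Helffer, *Courant-sharp eigenvalues for the equilateral torus, and for the equilateral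
  triangle*, Lett. Math. Phys. 106 (2016) 1729–1789, §10.2.
* [McKeanSinger1967] H. P. McKean, I. M. Singer, *Curvature and the eigenvalues of the Laplacian*, J. Differential Geom. 1 (1967)
  43–69, eq. (4a).
* [Kac1966] M. Kac, *Can one hear the shape of a drum?*, Amer. Math. Monthly 73 (1966) 1–23, §13–§15.
* [Gilkey1995] P. B. Gilkey, *Invariance theory, the heat equation, and the Atiyah–Singer index theorem*, 2nd ed. (1995), §1.10.
* [Berard1986] P. H. Bérard, *Spectral Geometry: Direct and Inverse Problems*, LNM 1207 (1986), Ch. III nº31, Ch. VII.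
-/

noncomputable section

open Real Filter Topology Set Asymptotics

namespace Literature.Analysis.InnerProduct

/-! ### §0 Normalisations -/

/-- `ℕ² = {x > y} ⊔ {x < y} ⊔ {x = y}` (as in rows g39-#6/#8/#10). [folklore] -/
private theorem hasSum_nat_prod_trichotomy' {F : ℕ × ℕ → ℝ} {l u d : ℝ}
    (hl : HasSum (fun q : ℕ × ℕ ↦ F (q.1 + q.2 + 1, q.2)) l) (hu : HasSum (fun q : ℕ × ℕ ↦ F (q.2, q.1 + q.2 + 1)) u)
    (hd : HasSum (fun n : ℕ ↦ F (n, n)) d) : HasSum F (l + (u + d)) := by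
  have hbij : Function.Bijective (Sum.elim (fun q : ℕ × ℕ ↦ (q.1 + q.2 + 1, q.2))
      (Sum.elim (fun q : ℕ × ℕ ↦ (q.2, q.1 + q.2 + 1)) (fun n : ℕ ↦ (n, n)))) := by
    refine ⟨?_, ?_⟩
    · rintro (⟨r, s⟩ | ⟨r, s⟩ | n) (⟨r', s'⟩ | ⟨r', s'⟩ | n') h <;>
        simp only [Sum.elim_inl, Sum.elim_inr, Sum.inl.injEq, Sum.inr.injEq, Prod.mk.injEq, reduceCtorEq] at h ⊢ <;>
        omega
    · rintro ⟨x, y⟩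
      rcases lt_trichotomy y x with hxy | rfl | hxy
      · refine ⟨Sum.inl (x - y - 1, y), ?_⟩
        show (x - y - 1 + y + 1, y) = (x, y)
        rw [show x - y - 1 + y + 1 = x by omega]
      · exact ⟨Sum.inr (Sum.inr y), rfl⟩
      · refine ⟨Sum.inr (Sum.inl (y - x - 1, x)), ?_⟩
        show (x, y - x - 1 + x + 1) = (x, y)
        rw [show y - x - 1 + x + 1 = y by omega]
  exact (Equiv.ofBijective _ hbij).hasSum_iff.mp
    (HasSum.sum (f := F ∘ Sum.elim (fun q : ℕ × ℕ ↦ (q.1 + q.2 + 1, q.2))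
      (Sum.elim (fun q : ℕ × ℕ ↦ (q.2, q.1 + q.2 + 1)) (fun n : ℕ ↦ (n, n)))) hl (HasSum.sum hu hd))

/-- `(π/(√3ℓ/4))² = 3c`, `c = (4π/(3ℓ))²`: the diagonal `m = n` of Lamé's spectrum is the Dirichlet interval of length `√3ℓ/4`.
[folklore] -/
private theorem sq_pi_div_sqrt_three_mul {ℓ : ℝ} (hℓ : 0 < ℓ) : (π / (Real.sqrt 3 * ℓ / 4)) ^ 2 = 3 * (4 * π / (3 * ℓ)) ^ 2 := by
  have h3 : Real.sqrt 3 ^ 2 = 3 := Real.sq_sqrt (by norm_num)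
  have hs0 : Real.sqrt 3 ≠ 0 := (Real.sqrt_pos.mpr (by norm_num)).ne'
  have hℓ0 : ℓ ≠ 0 := hℓ.ne'
  rw [div_pow, div_pow, div_pow, mul_pow, h3]
  field_simp

/-- `√3ℓ/4/(2√π) = … `: the boundary coefficient `½·3ℓ/(8√π) + ½·(√3ℓ/4)/(2√π) = (3+√3)ℓ/(16√π)`. [folklore] -/
private theorem hemi_boundary_coeff (ℓ : ℝ) :
    1 / 2 * (3 * ℓ / (8 * π ^ (1 / 2 : ℝ))) + 1 / 2 * (Real.sqrt 3 * ℓ / 4 / (2 * π ^ (1 / 2 : ℝ))) =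
      (3 + Real.sqrt 3) * ℓ / (16 * π ^ (1 / 2 : ℝ)) := by
  have hs0 : π ^ (1 / 2 : ℝ) ≠ 0 := (Real.rpow_pos_of_pos Real.pi_pos _).ne'
  field_simp
  ring

/-- **KAC'S CORNER TERMS FOR THE HEMIEQUILATERAL TRIANGLE**: inside-facing angles `π/2`, `π/3`, `π/6`,
`(π²−(π/2)²)/(24π·π/2) + (π²−(π/3)²)/(24π·π/3) + (π²−(π/6)²)/(24π·π/6) = 1/16 + 1/9 + 35/144 = 5/12`.
[cite: McKeanSinger1967, eq. (4a) p. 43–44] -/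
theorem kac_corner_terms_hemiequilateralTriangle :
    (π ^ 2 - (π / 2) ^ 2) / (24 * π * (π / 2)) + (π ^ 2 - (π / 3) ^ 2) / (24 * π * (π / 3)) +
      (π ^ 2 - (π / 6) ^ 2) / (24 * π * (π / 6)) = (5 / 12 : ℝ) := by
  have hπ : π ≠ 0 := Real.pi_pos.ne'
  field_simp
  ring

/-! ### §1 The Dirichlet spectrum of `H_ℓ` and `Z_H = (Z_T − ∑_{n≥1}e^{−3tcn²})/2` -/

section Triangle

variable {ℓ : ℝ}

/-- **THE DIRICHLET SPECTRUM OF THE HEMIEQUILATERAL TRIANGLE `H_ℓ` (angles `π/2, π/3, π/6`, hypotenuse `ℓ`) AS A FAMILY**: "A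
complete set of Dirichlet eigenfunctions of the hemiequilateral triangle `H`, with hypothenuse of length `1`, is given by the
functions `C_{m,n}` … with `1 ≤ n < m`. The associated eigenvalues are the numbers `(16π²/9)(m²+mn+n²)`" — the `T`-eigenfunctions
odd under the reflection in a median. Index `(r,s) ∈ ℕ × ℕ`, `m = r+s+2`, `n = s+1`. The heat trace converges.
[cite: BerardHelffer2016, §10.2 (verbatim above); Berard1986, Ch. III nº31] -/
theorem summable_exp_neg_mul_hemiequilateralTriangle (hℓ : 0 < ℓ) {t : ℝ} (ht : 0 < t) :
    Summable fun p : ℕ × ℕ ↦ Real.exp (-(t * ((4 * π / (3 * ℓ)) ^ 2 * (((p.1 : ℝ) + p.2 + 2) ^ 2 + ((p.1 : ℝ) + p.2 + 2) * ((p.2 : ℝ) + 1) + ((p.2 : ℝ) + 1) ^ 2)))) := by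
  have hinj : Function.Injective fun q : ℕ × ℕ ↦ (q.1 + q.2 + 1, q.2) := fun q q' h ↦ by
    simp only [Prod.mk.injEq] at h
    exact Prod.ext (by omega) h.2
  refine ((summable_exp_neg_mul_equilateralTriangle hℓ ht).comp_injective hinj).congr fun q ↦ ?_
  simp only [Function.comp_apply]
  congr 1
  push_cast
  ring

/-- **`Z_{T_ℓ} = 2Z_{H_ℓ} + ∑_{n≥0}e^{−3tc(n+1)²}`**: Lamé's index set `{m,n ≥ 1}` is `{m > n} ⊔ {m < n} ⊔ {m = n}`, the form
`m² + mn + n²` is symmetric, and `Q(n,n) = 3n²`. [cite: BerardHelffer2016, §10.2 with Proposition 4.1] -/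
theorem tsum_exp_neg_mul_equilateralTriangle_eq_hemi (hℓ : 0 < ℓ) {t : ℝ} (ht : 0 < t) :
    ∑' p : ℕ × ℕ, Real.exp (-(t * ((4 * π / (3 * ℓ)) ^ 2 * (((p.1 : ℝ) + 1) ^ 2 + ((p.1 : ℝ) + 1) * ((p.2 : ℝ) + 1) + ((p.2 : ℝ) + 1) ^ 2)))) =
      2 * (∑' p : ℕ × ℕ, Real.exp (-(t * ((4 * π / (3 * ℓ)) ^ 2 * (((p.1 : ℝ) + p.2 + 2) ^ 2 + ((p.1 : ℝ) + p.2 + 2) * ((p.2 : ℝ) + 1) + ((p.2 : ℝ) + 1) ^ 2))))) +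
        ∑' n : ℕ, Real.exp (-(t * (3 * (4 * π / (3 * ℓ)) ^ 2 * ((n : ℝ) + 1) ^ 2))) := by
  have ha : (0 : ℝ) < Real.sqrt 3 * ℓ / 4 := by positivity
  have hH := (summable_exp_neg_mul_hemiequilateralTriangle hℓ ht).hasSum
  have hWs := summable_exp_neg_mul_dirichletInterval ha ht
  rw [sq_pi_div_sqrt_three_mul hℓ] at hWs
  have h := hasSum_nat_prod_trichotomy' (F := fun p : ℕ × ℕ ↦ Real.exp (-(t * ((4 * π / (3 * ℓ)) ^ 2 * (((p.1 : ℝ) + 1) ^ 2 + ((p.1 : ℝ) + 1) * ((p.2 : ℝ) + 1) + ((p.2 : ℝ) + 1) ^ 2)))))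
    (hH.congr_fun fun q ↦ by dsimp only; congr 1; push_cast; ring)
    (hH.congr_fun fun q ↦ by dsimp only; congr 1; push_cast; ring)
    (hWs.hasSum.congr_fun fun n ↦ by dsimp only; congr 1; ring)
  rw [h.tsum_eq]
  ring

/-- **`Z_{H_ℓ} = (Z_{T_ℓ} − ∑_{n≥0}e^{−3tc(n+1)²})/2`.** [cite: BerardHelffer2016, §10.2] -/
theorem tsum_exp_neg_mul_hemiequilateralTriangle (hℓ : 0 < ℓ) {t : ℝ} (ht : 0 < t) :
    ∑' p : ℕ × ℕ, Real.exp (-(t * ((4 * π / (3 * ℓ)) ^ 2 * (((p.1 : ℝ) + p.2 + 2) ^ 2 + ((p.1 : ℝ) + p.2 + 2) * ((p.2 : ℝ) + 1) + ((p.2 : ℝ) + 1) ^ 2)))) =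
      ((∑' p : ℕ × ℕ, Real.exp (-(t * ((4 * π / (3 * ℓ)) ^ 2 * (((p.1 : ℝ) + 1) ^ 2 + ((p.1 : ℝ) + 1) * ((p.2 : ℝ) + 1) + ((p.2 : ℝ) + 1) ^ 2))))) -
        ∑' n : ℕ, Real.exp (-(t * (3 * (4 * π / (3 * ℓ)) ^ 2 * ((n : ℝ) + 1) ^ 2)))) / 2 := by
  rw [tsum_exp_neg_mul_equilateralTriangle_eq_hemi hℓ ht]
  ring

/-- **KAC'S FORMULA FOR THE 30°–60°–90° TRIANGLE, TO ALL ORDERS: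
`Z_{H_ℓ}(t) − ((√3/8)ℓ²/(4π)·t^{−1} − (3+√3)ℓ/(16√π)·t^{−1/2} + 5/12) = O(t^β)` for EVERY `β`** — area `(√3/8)ℓ²`, perimeter
`(3+√3)ℓ/2` (legs `ℓ/2`, `(√3/2)ℓ`, hypotenuse `ℓ`), corners `π/2, π/3, π/6` contributing `1/16 + 1/9 + 35/144 = 5/12`:
`½(Z_T-expansion, constant 1/3) − ½((√3ℓ/4)/(2√π)t^{−1/2} − ½)`. [cite: McKeanSinger1967, eq. (4a) p. 43–44; BerardHelffer2016,
§10.2; Kac1966, §14] -/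
theorem isBigO_hemiequilateralTriangle_heatTrace_sub (hℓ : 0 < ℓ) (β : ℝ) :
    (fun t : ℝ ↦ ∑' p : ℕ × ℕ, Real.exp (-(t * ((4 * π / (3 * ℓ)) ^ 2 * (((p.1 : ℝ) + p.2 + 2) ^ 2 + ((p.1 : ℝ) + p.2 + 2) * ((p.2 : ℝ) + 1) + ((p.2 : ℝ) + 1) ^ 2)))) -
      (Real.sqrt 3 * ℓ ^ 2 / (32 * π) * t ^ (-1 : ℝ) - (3 + Real.sqrt 3) * ℓ / (16 * π ^ (1 / 2 : ℝ)) * t ^ (-(1 / 2 : ℝ)) +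
        5 / 12)) =O[𝓝[>] 0] fun t : ℝ ↦ t ^ β := by
  have ha : (0 : ℝ) < Real.sqrt 3 * ℓ / 4 := by positivity
  have hT := isBigO_equilateralTriangle_heatTrace_sub hℓ β
  have hW := isBigO_dirichletInterval_heatTrace_sub ha β
  have e := hemi_boundary_coeff ℓ
  refine ((hT.const_mul_left (1 / 2)).sub (hW.const_mul_left (1 / 2))).congr' ?_ EventuallyEq.rfl
  filter_upwards [self_mem_nhdsWithin] with t (ht : 0 < t)
  rw [tsum_exp_neg_mul_hemiequilateralTriangle hℓ ht, sq_pi_div_sqrt_three_mul hℓ]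
  linear_combination (-(t ^ (-(1 / 2 : ℝ)))) * e

/-- **KAC'S FORMULA (4a), VERBATIM SHAPE, FOR `H_ℓ`:
`Z(t) − (area/(4πt) − length/(8√(πt)) + ∑_corners (π²−γ²)/(24πγ)) = O(t^β)`**, `area = (√3/8)ℓ²`, `length = (3+√3)ℓ/2`,
corners `γ = π/2, π/3, π/6`. [cite: McKeanSinger1967, eq. (4a) p. 43–44 and footnote 1; Kac1966, §14] -/
theorem isBigO_hemiequilateralTriangle_heatTrace_sub_kac (hℓ : 0 < ℓ) (β : ℝ) :
    (fun t : ℝ ↦ ∑' p : ℕ × ℕ, Real.exp (-(t * ((4 * π / (3 * ℓ)) ^ 2 * (((p.1 : ℝ) + p.2 + 2) ^ 2 + ((p.1 : ℝ) + p.2 + 2) * ((p.2 : ℝ) + 1) + ((p.2 : ℝ) + 1) ^ 2)))) -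
      (Real.sqrt 3 / 8 * ℓ ^ 2 / (4 * π * t) - (3 + Real.sqrt 3) * ℓ / 2 / (8 * (π * t) ^ (1 / 2 : ℝ)) +
        ((π ^ 2 - (π / 2) ^ 2) / (24 * π * (π / 2)) + (π ^ 2 - (π / 3) ^ 2) / (24 * π * (π / 3)) +
          (π ^ 2 - (π / 6) ^ 2) / (24 * π * (π / 6))))) =O[𝓝[>] 0] fun t : ℝ ↦ t ^ β := by
  refine (isBigO_hemiequilateralTriangle_heatTrace_sub hℓ β).congr' ?_ EventuallyEq.rfl
  filter_upwards [self_mem_nhdsWithin] with t (ht : 0 < t)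
  have hsq : π ^ (1 / 2 : ℝ) * π ^ (1 / 2 : ℝ) = π := by
    rw [← Real.rpow_add Real.pi_pos]; norm_num
  have hs0 : π ^ (1 / 2 : ℝ) ≠ 0 := (Real.rpow_pos_of_pos Real.pi_pos _).ne'
  have hu0 : t ^ (1 / 2 : ℝ) ≠ 0 := (Real.rpow_pos_of_pos ht _).ne'
  have ht0 : t ≠ 0 := ht.ne'
  rw [kac_corner_terms_hemiequilateralTriangle, Real.mul_rpow Real.pi_pos.le ht.le, Real.rpow_neg_one, Real.rpow_neg ht.le]
  congr 1
  set s := π ^ (1 / 2 : ℝ) with hs_def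
  set u := t ^ (1 / 2 : ℝ) with hu_def
  rw [show π = s * s from hsq.symm]
  field_simp
  ring

/-- The expansion in the format of the abstract theory: `κ = Fin 3`, `a = ((√3/8)ℓ²/(4π), −(3+√3)ℓ/(16√π), 5/12)`,
`α = (−1, −½, 0)`. [cite: McKeanSinger1967, eq. (4a); Gilkey1995, §1.10 Lemma 1.10.1 (the expansion hypothesis)] -/
theorem isBigO_hemiequilateralTriangle_heatTrace_expansion (hℓ : 0 < ℓ) (β : ℝ) :
    (fun t : ℝ ↦ ∑' p : ℕ × ℕ, Real.exp (-(t * ((4 * π / (3 * ℓ)) ^ 2 * (((p.1 : ℝ) + p.2 + 2) ^ 2 + ((p.1 : ℝ) + p.2 + 2) * ((p.2 : ℝ) + 1) + ((p.2 : ℝ) + 1) ^ 2)))) -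
      ∑ k : Fin 3, (![Real.sqrt 3 * ℓ ^ 2 / (32 * π), -((3 + Real.sqrt 3) * ℓ / (16 * π ^ (1 / 2 : ℝ))), 5 / 12] : Fin 3 → ℝ) k *
        t ^ ((![(-1 : ℝ), -(1 / 2 : ℝ), 0] : Fin 3 → ℝ) k)) =O[𝓝[>] 0] fun t : ℝ ↦ t ^ β := by
  refine (isBigO_hemiequilateralTriangle_heatTrace_sub hℓ β).congr' ?_ EventuallyEq.rfl
  filter_upwards [self_mem_nhdsWithin] with t (ht : 0 < t)
  simp only [Fin.sum_univ_three, Matrix.cons_val_zero, Matrix.cons_val_one, Matrix.cons_val, Real.rpow_zero, mul_one]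
  ring

/-- The Dirichlet spectrum of `H_ℓ` is discrete. [cite: BerardHelffer2016, §10.2] -/
theorem tendsto_hemiequilateralTriangle_cofinite_atTop (hℓ : 0 < ℓ) :
    Tendsto (fun p : ℕ × ℕ ↦ (4 * π / (3 * ℓ)) ^ 2 * (((p.1 : ℝ) + p.2 + 2) ^ 2 + ((p.1 : ℝ) + p.2 + 2) * ((p.2 : ℝ) + 1) + ((p.2 : ℝ) + 1) ^ 2)) cofinite atTop := by
  have hinj : Function.Injective fun q : ℕ × ℕ ↦ (q.1 + q.2 + 1, q.2) := fun q q' h ↦ by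
    simp only [Prod.mk.injEq] at h
    exact Prod.ext (by omega) h.2
  refine ((tendsto_equilateralTriangle_cofinite_atTop hℓ).comp hinj.tendsto_cofinite).congr fun q ↦ ?_
  simp only [Function.comp_apply]
  push_cast
  ring

/-- No zero modes (Dirichlet). [cite: BerardHelffer2016, §10.2] -/
theorem ncard_setOf_hemiequilateralTriangle_eq_zero (hℓ : 0 < ℓ) :
    {p : ℕ × ℕ | (4 * π / (3 * ℓ)) ^ 2 * (((p.1 : ℝ) + p.2 + 2) ^ 2 + ((p.1 : ℝ) + p.2 + 2) * ((p.2 : ℝ) + 1) + ((p.2 : ℝ) + 1) ^ 2) = 0}.ncard = 0 := by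
  have h : {p : ℕ × ℕ | (4 * π / (3 * ℓ)) ^ 2 * (((p.1 : ℝ) + p.2 + 2) ^ 2 + ((p.1 : ℝ) + p.2 + 2) * ((p.2 : ℝ) + 1) + ((p.2 : ℝ) + 1) ^ 2) = 0} = ∅ :=
    Set.eq_empty_of_forall_notMem fun p hp ↦ by
      have : (0 : ℝ) < (4 * π / (3 * ℓ)) ^ 2 * (((p.1 : ℝ) + p.2 + 2) ^ 2 + ((p.1 : ℝ) + p.2 + 2) * ((p.2 : ℝ) + 1) + ((p.2 : ℝ) + 1) ^ 2) := by positivity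
      exact this.ne' hp
  rw [h, Set.ncard_empty]

/-! ### §2 Consequences: Weyl `(√3/8)ℓ²/(4π)`, `Γζ_H`, and `ζ_H(0) = 5/12` -/

/-- **WEYL'S LAW FOR `H_ℓ`: `#{λ ≤ Λ}/Λ → (√3/8)ℓ²/(4π) = |H_ℓ|/(4π)`.** [cite: McKeanSinger1967, p. 43; Berard1986, Ch. VII nº10 (ii),
nº15 (16); BerardHelffer2016, §10.2 (the lower bound `N_H(λ) ≥ (√3/(32π))λ − ((6+√3)/(8π))√λ + ½`)] -/
theorem tendsto_ncard_hemiequilateralTriangle_le_div (hℓ : 0 < ℓ) :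
    Tendsto (fun l : ℝ ↦ (({p : ℕ × ℕ | (4 * π / (3 * ℓ)) ^ 2 * (((p.1 : ℝ) + p.2 + 2) ^ 2 + ((p.1 : ℝ) + p.2 + 2) * ((p.2 : ℝ) + 1) + ((p.2 : ℝ) + 1) ^ 2) ≤ l}.ncard : ℕ) : ℝ) / l) atTop
      (𝓝 (Real.sqrt 3 * ℓ ^ 2 / (32 * π))) := by
  have hexp : (fun t : ℝ ↦ ∑' p : ℕ × ℕ, Real.exp (-(((4 * π / (3 * ℓ)) ^ 2 * (((p.1 : ℝ) + p.2 + 2) ^ 2 + ((p.1 : ℝ) + p.2 + 2) * ((p.2 : ℝ) + 1) + ((p.2 : ℝ) + 1) ^ 2)) * t)) -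
      ∑ k : Fin 3, (![Real.sqrt 3 * ℓ ^ 2 / (32 * π), -((3 + Real.sqrt 3) * ℓ / (16 * π ^ (1 / 2 : ℝ))), 5 / 12] : Fin 3 → ℝ) k *
        t ^ ((![(-1 : ℝ), -(1 / 2 : ℝ), 0] : Fin 3 → ℝ) k)) =O[𝓝[>] 0] fun t : ℝ ↦ t ^ (0 : ℝ) := by
    refine (isBigO_hemiequilateralTriangle_heatTrace_expansion hℓ 0).congr' ?_ EventuallyEq.rfl
    filter_upwards with t
    congr 1
    exact tsum_congr fun p ↦ by rw [mul_comm]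
  have hsum : ∀ t : ℝ, 0 < t → Summable fun p : ℕ × ℕ ↦ Real.exp (-(((4 * π / (3 * ℓ)) ^ 2 * (((p.1 : ℝ) + p.2 + 2) ^ 2 + ((p.1 : ℝ) + p.2 + 2) * ((p.2 : ℝ) + 1) + ((p.2 : ℝ) + 1) ^ 2)) * t)) :=
    fun t ht ↦ (summable_exp_neg_mul_hemiequilateralTriangle hℓ ht).congr fun p ↦ by rw [mul_comm]
  have h := tendsto_ncard_le_div_rpow_of_expansion (μ := fun p : ℕ × ℕ ↦ (4 * π / (3 * ℓ)) ^ 2 * (((p.1 : ℝ) + p.2 + 2) ^ 2 + ((p.1 : ℝ) + p.2 + 2) * ((p.2 : ℝ) + 1) + ((p.2 : ℝ) + 1) ^ 2)) (ρ := 1)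
    (fun p ↦ by positivity) hsum hexp (fun k ↦ by fin_cases k <;> norm_num) (by norm_num) (by norm_num)
  have e : (∑ k : Fin 3, if (![(-1 : ℝ), -(1 / 2 : ℝ), 0] : Fin 3 → ℝ) k = -1 then
      (![Real.sqrt 3 * ℓ ^ 2 / (32 * π), -((3 + Real.sqrt 3) * ℓ / (16 * π ^ (1 / 2 : ℝ))), 5 / 12] : Fin 3 → ℝ) k else 0) / Real.Gamma (1 + 1) =
      Real.sqrt 3 * ℓ ^ 2 / (32 * π) := by
    rw [Fin.sum_univ_three]
    simp only [Matrix.cons_val_zero, Matrix.cons_val_one, Matrix.cons_val, if_true,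
      show ¬(-(1 / 2 : ℝ) = -1) by norm_num, show ¬((0 : ℝ) = -1) by norm_num, if_false, add_zero,
      show (1 : ℝ) + 1 = 2 by norm_num, Real.Gamma_two, div_one]
  rw [e] at h
  refine h.congr' ?_
  filter_upwards with l
  rw [Real.rpow_one]

/-- **GILKEY'S LEMMA 1.10.1 FOR `H_ℓ`: on `Re s > 1`, `Γ(s)·ζ_H(s) = ∑ₖ aₖ/(s + αₖ) − 0/s + r(s)`**, `(aₖ) = ((√3/8)ℓ²/(4π),
−(3+√3)ℓ/(16√π), 5/12)`, `(αₖ) = (−1, −½, 0)`, `r` entire. [cite: Gilkey1995, §1.10 Lemma 1.10.1; McKeanSinger1967, eq. (4a)] -/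
theorem Gamma_mul_tsum_hemiequilateralTriangle_cpow_neg_eq (hℓ : 0 < ℓ) {s : ℂ} (hs : 1 < s.re) :
    Complex.Gamma s * ∑' p : {p : ℕ × ℕ | (4 * π / (3 * ℓ)) ^ 2 * (((p.1 : ℝ) + p.2 + 2) ^ 2 + ((p.1 : ℝ) + p.2 + 2) * ((p.2 : ℝ) + 1) + ((p.2 : ℝ) + 1) ^ 2) ≠ 0},
        ((((4 * π / (3 * ℓ)) ^ 2 * ((((p : ℕ × ℕ).1 : ℝ) + (p : ℕ × ℕ).2 + 2) ^ 2 + (((p : ℕ × ℕ).1 : ℝ) + (p : ℕ × ℕ).2 + 2) * (((p : ℕ × ℕ).2 : ℝ) + 1) + (((p : ℕ × ℕ).2 : ℝ) + 1) ^ 2)) : ℝ) : ℂ) ^ (-s) =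
      (∑ k : Fin 3, ((![Real.sqrt 3 * ℓ ^ 2 / (32 * π), -((3 + Real.sqrt 3) * ℓ / (16 * π ^ (1 / 2 : ℝ))), 5 / 12] : Fin 3 → ℝ) k : ℂ) /
            (s + ((![(-1 : ℝ), -(1 / 2 : ℝ), 0] : Fin 3 → ℝ) k : ℝ)) -
          ({p : ℕ × ℕ | (4 * π / (3 * ℓ)) ^ 2 * (((p.1 : ℝ) + p.2 + 2) ^ 2 + ((p.1 : ℝ) + p.2 + 2) * ((p.2 : ℝ) + 1) + ((p.2 : ℝ) + 1) ^ 2) = 0}.ncard : ℂ) / s +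
        mellin (fun t : ℝ ↦ ((∑' p : {p : ℕ × ℕ | (4 * π / (3 * ℓ)) ^ 2 * (((p.1 : ℝ) + p.2 + 2) ^ 2 + ((p.1 : ℝ) + p.2 + 2) * ((p.2 : ℝ) + 1) + ((p.2 : ℝ) + 1) ^ 2) ≠ 0},
            Real.exp (-(t * ((4 * π / (3 * ℓ)) ^ 2 * ((((p : ℕ × ℕ).1 : ℝ) + (p : ℕ × ℕ).2 + 2) ^ 2 + (((p : ℕ × ℕ).1 : ℝ) + (p : ℕ × ℕ).2 + 2) * (((p : ℕ × ℕ).2 : ℝ) + 1) + (((p : ℕ × ℕ).2 : ℝ) + 1) ^ 2)))) : ℝ) : ℂ) -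
          (Ioc 0 1).indicator (fun t : ℝ ↦ ((∑ k : Fin 3, (![Real.sqrt 3 * ℓ ^ 2 / (32 * π), -((3 + Real.sqrt 3) * ℓ / (16 * π ^ (1 / 2 : ℝ))), 5 / 12] : Fin 3 → ℝ) k *
              t ^ ((![(-1 : ℝ), -(1 / 2 : ℝ), 0] : Fin 3 → ℝ) k) : ℝ) : ℂ) -
            ({p : ℕ × ℕ | (4 * π / (3 * ℓ)) ^ 2 * (((p.1 : ℝ) + p.2 + 2) ^ 2 + ((p.1 : ℝ) + p.2 + 2) * ((p.2 : ℝ) + 1) + ((p.2 : ℝ) + 1) ^ 2) = 0}.ncard : ℂ)) t) s) := by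
  have h := Gamma_mul_tsum_cpow_neg_eq_of_expansion (μ := fun p : ℕ × ℕ ↦ (4 * π / (3 * ℓ)) ^ 2 * (((p.1 : ℝ) + p.2 + 2) ^ 2 + ((p.1 : ℝ) + p.2 + 2) * ((p.2 : ℝ) + 1) + ((p.2 : ℝ) + 1) ^ 2))
    (a := ![Real.sqrt 3 * ℓ ^ 2 / (32 * π), -((3 + Real.sqrt 3) * ℓ / (16 * π ^ (1 / 2 : ℝ))), 5 / 12]) (α := ![(-1 : ℝ), -(1 / 2 : ℝ), 0])
    (β := 1) (σ := 1) (fun p ↦ by positivity) (tendsto_hemiequilateralTriangle_cofinite_atTop hℓ)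
    (fun t ht ↦ summable_exp_neg_mul_hemiequilateralTriangle hℓ ht) (isBigO_hemiequilateralTriangle_heatTrace_expansion hℓ 1)
    (by norm_num) (by norm_num) (fun k ↦ by fin_cases k <;> norm_num) hs
  exact h

/-- **`ζ_H(0) = 5/12`: THE CORNERS `π/2, π/3, π/6` ARE THE VALUE OF THE CONTINUED ZETA FUNCTION AT `0`** (no zero modes).
[cite: Gilkey1995, §1.10 Lemma 1.10.1; McKeanSinger1967, eq. (4a)] -/
theorem tendsto_hemiequilateralTriangleZeta_continuation_nhdsNE_zero (hℓ : 0 < ℓ) :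
    Tendsto (fun s : ℂ ↦ (Complex.Gamma s)⁻¹ *
        (∑ k : Fin 3, ((![Real.sqrt 3 * ℓ ^ 2 / (32 * π), -((3 + Real.sqrt 3) * ℓ / (16 * π ^ (1 / 2 : ℝ))), 5 / 12] : Fin 3 → ℝ) k : ℂ) /
            (s + ((![(-1 : ℝ), -(1 / 2 : ℝ), 0] : Fin 3 → ℝ) k : ℝ)) -
          ({p : ℕ × ℕ | (4 * π / (3 * ℓ)) ^ 2 * (((p.1 : ℝ) + p.2 + 2) ^ 2 + ((p.1 : ℝ) + p.2 + 2) * ((p.2 : ℝ) + 1) + ((p.2 : ℝ) + 1) ^ 2) = 0}.ncard : ℂ) / s +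
        mellin (fun t : ℝ ↦ ((∑' p : {p : ℕ × ℕ | (4 * π / (3 * ℓ)) ^ 2 * (((p.1 : ℝ) + p.2 + 2) ^ 2 + ((p.1 : ℝ) + p.2 + 2) * ((p.2 : ℝ) + 1) + ((p.2 : ℝ) + 1) ^ 2) ≠ 0},
            Real.exp (-(t * ((4 * π / (3 * ℓ)) ^ 2 * ((((p : ℕ × ℕ).1 : ℝ) + (p : ℕ × ℕ).2 + 2) ^ 2 + (((p : ℕ × ℕ).1 : ℝ) + (p : ℕ × ℕ).2 + 2) * (((p : ℕ × ℕ).2 : ℝ) + 1) + (((p : ℕ × ℕ).2 : ℝ) + 1) ^ 2)))) : ℝ) : ℂ) -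
          (Ioc 0 1).indicator (fun t : ℝ ↦ ((∑ k : Fin 3, (![Real.sqrt 3 * ℓ ^ 2 / (32 * π), -((3 + Real.sqrt 3) * ℓ / (16 * π ^ (1 / 2 : ℝ))), 5 / 12] : Fin 3 → ℝ) k *
              t ^ ((![(-1 : ℝ), -(1 / 2 : ℝ), 0] : Fin 3 → ℝ) k) : ℝ) : ℂ) -
            ({p : ℕ × ℕ | (4 * π / (3 * ℓ)) ^ 2 * (((p.1 : ℝ) + p.2 + 2) ^ 2 + ((p.1 : ℝ) + p.2 + 2) * ((p.2 : ℝ) + 1) + ((p.2 : ℝ) + 1) ^ 2) = 0}.ncard : ℂ)) t) s))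
      (𝓝[≠] 0) (𝓝 (5 / 12)) := by
  have h := tendsto_continuation_nhdsNE_zero (μ := fun p : ℕ × ℕ ↦ (4 * π / (3 * ℓ)) ^ 2 * (((p.1 : ℝ) + p.2 + 2) ^ 2 + ((p.1 : ℝ) + p.2 + 2) * ((p.2 : ℝ) + 1) + ((p.2 : ℝ) + 1) ^ 2))
    (a := ![Real.sqrt 3 * ℓ ^ 2 / (32 * π), -((3 + Real.sqrt 3) * ℓ / (16 * π ^ (1 / 2 : ℝ))), 5 / 12]) (α := ![(-1 : ℝ), -(1 / 2 : ℝ), 0])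
    (β := 1) (fun p ↦ by positivity) (tendsto_hemiequilateralTriangle_cofinite_atTop hℓ)
    (fun t ht ↦ summable_exp_neg_mul_hemiequilateralTriangle hℓ ht) (isBigO_hemiequilateralTriangle_heatTrace_expansion hℓ 1)
    one_pos
  have e : ((∑ k : Fin 3, if (![(-1 : ℝ), -(1 / 2 : ℝ), 0] : Fin 3 → ℝ) k = 0 then
      ((![Real.sqrt 3 * ℓ ^ 2 / (32 * π), -((3 + Real.sqrt 3) * ℓ / (16 * π ^ (1 / 2 : ℝ))), 5 / 12] : Fin 3 → ℝ) k : ℂ) else 0) -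
      ({p : ℕ × ℕ | (4 * π / (3 * ℓ)) ^ 2 * (((p.1 : ℝ) + p.2 + 2) ^ 2 + ((p.1 : ℝ) + p.2 + 2) * ((p.2 : ℝ) + 1) + ((p.2 : ℝ) + 1) ^ 2) = 0}.ncard : ℂ)) = 5 / 12 := by
    rw [ncard_setOf_hemiequilateralTriangle_eq_zero hℓ, Fin.sum_univ_three]
    simp only [Matrix.cons_val_zero, Matrix.cons_val_one, Matrix.cons_val,
      show ¬((-1 : ℝ) = 0) by norm_num, show ¬(-(1 / 2 : ℝ) = 0) by norm_num, if_false, if_true, zero_add,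
      Nat.cast_zero, sub_zero]
    push_cast
    ring
  rw [e] at h
  exact h

/-- **The continued `ζ_H` is ANALYTIC at `s = 0` with value `5/12`.** [cite: Gilkey1995, §1.10 Lemma 1.10.1] -/
theorem exists_analyticAt_hemiequilateralTriangleZeta_continuation_zero (hℓ : 0 < ℓ) :
    ∃ Z : ℂ → ℂ, AnalyticAt ℂ Z 0 ∧ Z 0 = 5 / 12 ∧
      ∀ᶠ s in 𝓝[≠] (0 : ℂ), Z s = (Complex.Gamma s)⁻¹ *
        (∑ k : Fin 3, ((![Real.sqrt 3 * ℓ ^ 2 / (32 * π), -((3 + Real.sqrt 3) * ℓ / (16 * π ^ (1 / 2 : ℝ))), 5 / 12] : Fin 3 → ℝ) k : ℂ) /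
            (s + ((![(-1 : ℝ), -(1 / 2 : ℝ), 0] : Fin 3 → ℝ) k : ℝ)) -
          ({p : ℕ × ℕ | (4 * π / (3 * ℓ)) ^ 2 * (((p.1 : ℝ) + p.2 + 2) ^ 2 + ((p.1 : ℝ) + p.2 + 2) * ((p.2 : ℝ) + 1) + ((p.2 : ℝ) + 1) ^ 2) = 0}.ncard : ℂ) / s +
        mellin (fun t : ℝ ↦ ((∑' p : {p : ℕ × ℕ | (4 * π / (3 * ℓ)) ^ 2 * (((p.1 : ℝ) + p.2 + 2) ^ 2 + ((p.1 : ℝ) + p.2 + 2) * ((p.2 : ℝ) + 1) + ((p.2 : ℝ) + 1) ^ 2) ≠ 0},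
            Real.exp (-(t * ((4 * π / (3 * ℓ)) ^ 2 * ((((p : ℕ × ℕ).1 : ℝ) + (p : ℕ × ℕ).2 + 2) ^ 2 + (((p : ℕ × ℕ).1 : ℝ) + (p : ℕ × ℕ).2 + 2) * (((p : ℕ × ℕ).2 : ℝ) + 1) + (((p : ℕ × ℕ).2 : ℝ) + 1) ^ 2)))) : ℝ) : ℂ) -
          (Ioc 0 1).indicator (fun t : ℝ ↦ ((∑ k : Fin 3, (![Real.sqrt 3 * ℓ ^ 2 / (32 * π), -((3 + Real.sqrt 3) * ℓ / (16 * π ^ (1 / 2 : ℝ))), 5 / 12] : Fin 3 → ℝ) k *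
              t ^ ((![(-1 : ℝ), -(1 / 2 : ℝ), 0] : Fin 3 → ℝ) k) : ℝ) : ℂ) -
            ({p : ℕ × ℕ | (4 * π / (3 * ℓ)) ^ 2 * (((p.1 : ℝ) + p.2 + 2) ^ 2 + ((p.1 : ℝ) + p.2 + 2) * ((p.2 : ℝ) + 1) + ((p.2 : ℝ) + 1) ^ 2) = 0}.ncard : ℂ)) t) s) := by
  obtain ⟨Z, hZ, hZ0, hZeq⟩ := exists_analyticAt_continuation_zero (μ := fun p : ℕ × ℕ ↦ (4 * π / (3 * ℓ)) ^ 2 * (((p.1 : ℝ) + p.2 + 2) ^ 2 + ((p.1 : ℝ) + p.2 + 2) * ((p.2 : ℝ) + 1) + ((p.2 : ℝ) + 1) ^ 2))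
    (a := ![Real.sqrt 3 * ℓ ^ 2 / (32 * π), -((3 + Real.sqrt 3) * ℓ / (16 * π ^ (1 / 2 : ℝ))), 5 / 12]) (α := ![(-1 : ℝ), -(1 / 2 : ℝ), 0])
    (β := 1) (fun p ↦ by positivity) (tendsto_hemiequilateralTriangle_cofinite_atTop hℓ)
    (fun t ht ↦ summable_exp_neg_mul_hemiequilateralTriangle hℓ ht) (isBigO_hemiequilateralTriangle_heatTrace_expansion hℓ 1)
    one_pos
  refine ⟨Z, hZ, ?_, hZeq⟩
  rw [hZ0, ncard_setOf_hemiequilateralTriangle_eq_zero hℓ, Fin.sum_univ_three]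
  simp only [Matrix.cons_val_zero, Matrix.cons_val_one, Matrix.cons_val,
    show ¬((-1 : ℝ) = 0) by norm_num, show ¬(-(1 / 2 : ℝ) = 0) by norm_num, if_false, if_true, zero_add,
    Nat.cast_zero, sub_zero]
  push_cast
  ring

/-- **Residue `(√3/8)ℓ²/(4π) = |H_ℓ|/(4π)` of `ζ_H` at `s = 1`.** [cite: Gilkey1995, §1.10 Lemma 1.10.1] -/
theorem tendsto_sub_one_mul_hemiequilateralTriangleZeta_continuation (hℓ : 0 < ℓ) :
    Tendsto (fun s : ℂ ↦ (s - (1 : ℝ)) * ((Complex.Gamma s)⁻¹ *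
        (∑ k : Fin 3, ((![Real.sqrt 3 * ℓ ^ 2 / (32 * π), -((3 + Real.sqrt 3) * ℓ / (16 * π ^ (1 / 2 : ℝ))), 5 / 12] : Fin 3 → ℝ) k : ℂ) /
            (s + ((![(-1 : ℝ), -(1 / 2 : ℝ), 0] : Fin 3 → ℝ) k : ℝ)) -
          ({p : ℕ × ℕ | (4 * π / (3 * ℓ)) ^ 2 * (((p.1 : ℝ) + p.2 + 2) ^ 2 + ((p.1 : ℝ) + p.2 + 2) * ((p.2 : ℝ) + 1) + ((p.2 : ℝ) + 1) ^ 2) = 0}.ncard : ℂ) / s +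
        mellin (fun t : ℝ ↦ ((∑' p : {p : ℕ × ℕ | (4 * π / (3 * ℓ)) ^ 2 * (((p.1 : ℝ) + p.2 + 2) ^ 2 + ((p.1 : ℝ) + p.2 + 2) * ((p.2 : ℝ) + 1) + ((p.2 : ℝ) + 1) ^ 2) ≠ 0},
            Real.exp (-(t * ((4 * π / (3 * ℓ)) ^ 2 * ((((p : ℕ × ℕ).1 : ℝ) + (p : ℕ × ℕ).2 + 2) ^ 2 + (((p : ℕ × ℕ).1 : ℝ) + (p : ℕ × ℕ).2 + 2) * (((p : ℕ × ℕ).2 : ℝ) + 1) + (((p : ℕ × ℕ).2 : ℝ) + 1) ^ 2)))) : ℝ) : ℂ) -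
          (Ioc 0 1).indicator (fun t : ℝ ↦ ((∑ k : Fin 3, (![Real.sqrt 3 * ℓ ^ 2 / (32 * π), -((3 + Real.sqrt 3) * ℓ / (16 * π ^ (1 / 2 : ℝ))), 5 / 12] : Fin 3 → ℝ) k *
              t ^ ((![(-1 : ℝ), -(1 / 2 : ℝ), 0] : Fin 3 → ℝ) k) : ℝ) : ℂ) -
            ({p : ℕ × ℕ | (4 * π / (3 * ℓ)) ^ 2 * (((p.1 : ℝ) + p.2 + 2) ^ 2 + ((p.1 : ℝ) + p.2 + 2) * ((p.2 : ℝ) + 1) + ((p.2 : ℝ) + 1) ^ 2) = 0}.ncard : ℂ)) t) s)))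
      (𝓝[≠] ((1 : ℝ) : ℂ)) (𝓝 ((Real.sqrt 3 * ℓ ^ 2 / (32 * π) : ℝ) : ℂ)) := by
  have h := tendsto_sub_mul_continuation_nhdsNE (μ := fun p : ℕ × ℕ ↦ (4 * π / (3 * ℓ)) ^ 2 * (((p.1 : ℝ) + p.2 + 2) ^ 2 + ((p.1 : ℝ) + p.2 + 2) * ((p.2 : ℝ) + 1) + ((p.2 : ℝ) + 1) ^ 2))
    (a := ![Real.sqrt 3 * ℓ ^ 2 / (32 * π), -((3 + Real.sqrt 3) * ℓ / (16 * π ^ (1 / 2 : ℝ))), 5 / 12]) (α := ![(-1 : ℝ), -(1 / 2 : ℝ), 0])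
    (β := 1) (fun p ↦ by positivity) (tendsto_hemiequilateralTriangle_cofinite_atTop hℓ)
    (fun t ht ↦ summable_exp_neg_mul_hemiequilateralTriangle hℓ ht) (isBigO_hemiequilateralTriangle_heatTrace_expansion hℓ 1)
    (s₀ := 1) (by norm_num)
  have e : (Complex.Gamma ((1 : ℝ) : ℂ))⁻¹ *
      ((∑ k : Fin 3, if (![(-1 : ℝ), -(1 / 2 : ℝ), 0] : Fin 3 → ℝ) k = -(1 : ℝ) then
        ((![Real.sqrt 3 * ℓ ^ 2 / (32 * π), -((3 + Real.sqrt 3) * ℓ / (16 * π ^ (1 / 2 : ℝ))), 5 / 12] : Fin 3 → ℝ) k : ℂ) else 0) -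
        if (1 : ℝ) = 0 then ({p : ℕ × ℕ | (4 * π / (3 * ℓ)) ^ 2 * (((p.1 : ℝ) + p.2 + 2) ^ 2 + ((p.1 : ℝ) + p.2 + 2) * ((p.2 : ℝ) + 1) + ((p.2 : ℝ) + 1) ^ 2) = 0}.ncard : ℂ) else 0) =
      ((Real.sqrt 3 * ℓ ^ 2 / (32 * π) : ℝ) : ℂ) := by
    rw [Fin.sum_univ_three]
    simp only [Matrix.cons_val_zero, Matrix.cons_val_one, Matrix.cons_val, if_true,
      show ¬(-(1 / 2 : ℝ) = -1) by norm_num, show ¬((0 : ℝ) = -1) by norm_num, if_false, add_zero, one_ne_zero,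
      sub_zero, Complex.ofReal_one, Complex.Gamma_one, inv_one, one_mul]
  rw [e] at h
  exact h

end Triangle

/-! ### §3 One can hear that a triangular drum is hemiequilateral among rectangles (`¼`), equilateral (`1/3`) and isosceles right
(`3/8`) triangles: the corner term `5/12` -/

section HearTheShape

variable {ℓ a p q : ℝ}

/-- **`H_ℓ` IS NEVER DIRICHLET-ISOSPECTRAL TO A RECTANGLE** (`5/12 ≠ ¼`). [cite: McKeanSinger1967, eq. (4a); Kac1966, §14;
Berard1986, Ch. VII nº4–nº6] -/
theorem not_isospectral_hemiequilateralTriangle_rectangle (hℓ : 0 < ℓ) (hp : 0 < p) (hq : 0 < q) :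
    ¬ ∀ x : ℝ, {r : ℕ × ℕ | (4 * π / (3 * ℓ)) ^ 2 * (((r.1 : ℝ) + r.2 + 2) ^ 2 + ((r.1 : ℝ) + r.2 + 2) * ((r.2 : ℝ) + 1) + ((r.2 : ℝ) + 1) ^ 2) = x}.ncard =
      {r : ℕ × ℕ | (π / p) ^ 2 * ((r.1 : ℝ) + 1) ^ 2 + (π / q) ^ 2 * ((r.2 : ℝ) + 1) ^ 2 = x}.ncard := by
  intro hN
  have h := heatCoeff_eq_of_ncard_eq (μ := fun r : ℕ × ℕ ↦ (4 * π / (3 * ℓ)) ^ 2 * (((r.1 : ℝ) + r.2 + 2) ^ 2 + ((r.1 : ℝ) + r.2 + 2) * ((r.2 : ℝ) + 1) + ((r.2 : ℝ) + 1) ^ 2))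
    (ν := fun r : ℕ × ℕ ↦ (π / p) ^ 2 * ((r.1 : ℝ) + 1) ^ 2 + (π / q) ^ 2 * ((r.2 : ℝ) + 1) ^ 2)
    (α := ![(-1 : ℝ), -(1 / 2 : ℝ), 0]) (β := 1)
    (tendsto_hemiequilateralTriangle_cofinite_atTop hℓ) (tendsto_dirichletRectangle_cofinite_atTop hp hq) hN
    (fun i j hij ↦ by fin_cases i <;> fin_cases j <;> norm_num at hij <;> rfl)
    (fun k ↦ by fin_cases k <;> norm_num)
    (isBigO_hemiequilateralTriangle_heatTrace_expansion hℓ 1) (isBigO_dirichletRectangle_heatTrace_expansion hp hq 1)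
  have h2 := congrFun h 2
  simp only [Matrix.cons_val] at h2
  norm_num at h2

/-- **… NOR TO AN EQUILATERAL TRIANGLE** (`5/12 ≠ 1/3`, row g39-#10). [cite: McKeanSinger1967, eq. (4a); Kac1966, §14] -/
theorem not_isospectral_hemiequilateralTriangle_equilateralTriangle (hℓ : 0 < ℓ) (ha : 0 < a) :
    ¬ ∀ x : ℝ, {r : ℕ × ℕ | (4 * π / (3 * ℓ)) ^ 2 * (((r.1 : ℝ) + r.2 + 2) ^ 2 + ((r.1 : ℝ) + r.2 + 2) * ((r.2 : ℝ) + 1) + ((r.2 : ℝ) + 1) ^ 2) = x}.ncard =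
      {r : ℕ × ℕ | (4 * π / (3 * a)) ^ 2 * (((r.1 : ℝ) + 1) ^ 2 + ((r.1 : ℝ) + 1) * ((r.2 : ℝ) + 1) + ((r.2 : ℝ) + 1) ^ 2) = x}.ncard := by
  intro hN
  have h := heatCoeff_eq_of_ncard_eq (μ := fun r : ℕ × ℕ ↦ (4 * π / (3 * ℓ)) ^ 2 * (((r.1 : ℝ) + r.2 + 2) ^ 2 + ((r.1 : ℝ) + r.2 + 2) * ((r.2 : ℝ) + 1) + ((r.2 : ℝ) + 1) ^ 2))
    (ν := fun r : ℕ × ℕ ↦ (4 * π / (3 * a)) ^ 2 * (((r.1 : ℝ) + 1) ^ 2 + ((r.1 : ℝ) + 1) * ((r.2 : ℝ) + 1) + ((r.2 : ℝ) + 1) ^ 2))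
    (α := ![(-1 : ℝ), -(1 / 2 : ℝ), 0]) (β := 1)
    (tendsto_hemiequilateralTriangle_cofinite_atTop hℓ) (tendsto_equilateralTriangle_cofinite_atTop ha) hN
    (fun i j hij ↦ by fin_cases i <;> fin_cases j <;> norm_num at hij <;> rfl)
    (fun k ↦ by fin_cases k <;> norm_num)
    (isBigO_hemiequilateralTriangle_heatTrace_expansion hℓ 1) (isBigO_equilateralTriangle_heatTrace_expansion ha 1)
  have h2 := congrFun h 2
  simp only [Matrix.cons_val] at h2
  norm_num at h2

/-- **… NOR TO AN ISOSCELES RIGHT TRIANGLE** (`5/12 ≠ 3/8`, row g39-#6). [cite: McKeanSinger1967, eq. (4a); Kac1966, §14] -/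
theorem not_isospectral_hemiequilateralTriangle_isoscelesRightTriangle (hℓ : 0 < ℓ) (ha : 0 < a) :
    ¬ ∀ x : ℝ, {r : ℕ × ℕ | (4 * π / (3 * ℓ)) ^ 2 * (((r.1 : ℝ) + r.2 + 2) ^ 2 + ((r.1 : ℝ) + r.2 + 2) * ((r.2 : ℝ) + 1) + ((r.2 : ℝ) + 1) ^ 2) = x}.ncard =
      {r : ℕ × ℕ | (π / a) ^ 2 * (((r.1 : ℝ) + r.2 + 2) ^ 2 + ((r.2 : ℝ) + 1) ^ 2) = x}.ncard := by
  intro hN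
  have h := heatCoeff_eq_of_ncard_eq (μ := fun r : ℕ × ℕ ↦ (4 * π / (3 * ℓ)) ^ 2 * (((r.1 : ℝ) + r.2 + 2) ^ 2 + ((r.1 : ℝ) + r.2 + 2) * ((r.2 : ℝ) + 1) + ((r.2 : ℝ) + 1) ^ 2))
    (ν := fun r : ℕ × ℕ ↦ (π / a) ^ 2 * (((r.1 : ℝ) + r.2 + 2) ^ 2 + ((r.2 : ℝ) + 1) ^ 2))
    (α := ![(-1 : ℝ), -(1 / 2 : ℝ), 0]) (β := 1)
    (tendsto_hemiequilateralTriangle_cofinite_atTop hℓ) (tendsto_isoscelesRightTriangle_cofinite_atTop ha) hN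
    (fun i j hij ↦ by fin_cases i <;> fin_cases j <;> norm_num at hij <;> rfl)
    (fun k ↦ by fin_cases k <;> norm_num)
    (isBigO_hemiequilateralTriangle_heatTrace_expansion hℓ 1) (isBigO_isoscelesRightTriangle_heatTrace_expansion ha 1)
  have h2 := congrFun h 2
  simp only [Matrix.cons_val] at h2
  norm_num at h2

/-- **One can hear the hypotenuse of a hemiequilateral drum**: isospectral `H_ℓ`, `H_{ℓ'}` have `ℓ = ℓ'`.
[cite: McKeanSinger1967, p. 43, eq. (4a)] -/
theorem eq_of_isospectral_hemiequilateralTriangles {ℓ' : ℝ} (hℓ : 0 < ℓ) (hℓ' : 0 < ℓ')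
    (hN : ∀ x : ℝ, {r : ℕ × ℕ | (4 * π / (3 * ℓ)) ^ 2 * (((r.1 : ℝ) + r.2 + 2) ^ 2 + ((r.1 : ℝ) + r.2 + 2) * ((r.2 : ℝ) + 1) + ((r.2 : ℝ) + 1) ^ 2) = x}.ncard =
      {r : ℕ × ℕ | (4 * π / (3 * ℓ')) ^ 2 * (((r.1 : ℝ) + r.2 + 2) ^ 2 + ((r.1 : ℝ) + r.2 + 2) * ((r.2 : ℝ) + 1) + ((r.2 : ℝ) + 1) ^ 2) = x}.ncard) :
    ℓ = ℓ' := by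
  have h := heatCoeff_eq_of_ncard_eq (μ := fun r : ℕ × ℕ ↦ (4 * π / (3 * ℓ)) ^ 2 * (((r.1 : ℝ) + r.2 + 2) ^ 2 + ((r.1 : ℝ) + r.2 + 2) * ((r.2 : ℝ) + 1) + ((r.2 : ℝ) + 1) ^ 2))
    (ν := fun r : ℕ × ℕ ↦ (4 * π / (3 * ℓ')) ^ 2 * (((r.1 : ℝ) + r.2 + 2) ^ 2 + ((r.1 : ℝ) + r.2 + 2) * ((r.2 : ℝ) + 1) + ((r.2 : ℝ) + 1) ^ 2))
    (α := ![(-1 : ℝ), -(1 / 2 : ℝ), 0]) (β := 1)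
    (tendsto_hemiequilateralTriangle_cofinite_atTop hℓ) (tendsto_hemiequilateralTriangle_cofinite_atTop hℓ') hN
    (fun i j hij ↦ by fin_cases i <;> fin_cases j <;> norm_num at hij <;> rfl)
    (fun k ↦ by fin_cases k <;> norm_num)
    (isBigO_hemiequilateralTriangle_heatTrace_expansion hℓ 1) (isBigO_hemiequilateralTriangle_heatTrace_expansion hℓ' 1)
  have hπ : 0 < π := Real.pi_pos
  have hπ2 : 0 < π ^ (1 / 2 : ℝ) := Real.rpow_pos_of_pos hπ _
  have hs3 : 0 < 3 + Real.sqrt 3 := by positivity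
  have h1 := congrFun h 1
  simp only [Matrix.cons_val_one, Matrix.cons_val_zero] at h1
  field_simp at h1
  nlinarith [hs3, hπ2, mul_pos hs3 hπ2]

end HearTheShape

end Literature.Analysis.InnerProduct
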